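import Mathlib
import Summits.NavierStokesRegularity.NavierStokesRegularity.Theorems.SubOnsagerCeilingKPPairSlavingUniform
import HarnessLib

/-!
# Secondary sources of a KP network proper, I: the ν-uniform barrier at ENVELOPE SCALE
(helper file for crux stmt-NavierStokesRegularity-27057 `SubOnsagerCeiling.ForwardTailCeilingKP`,
`--supports … --as helper`; LEAD SE seat ns-senv-p1 as KEY-NS #146 (1) / #147 (3) hands for LEAD SOC;
builds on p646904 / p647152 / p647884 / p649868)

`kpProper_secondary_barrier`: the ν-uniform pair slaving lemma (`kpProper_source_envelope_uniform`,
p649868) instantiated at envelope scale with an explicit constant. For a KP network proper `α ∈ E₂(R)`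
(`|α| ≤ 1` on the shift set, non-zero feed weights `≥ 1/R`), `0 < ε₀ ≤ 1`, a forward source `a` at shell
`n` with a target `e`, and a scale `A > 0` such that along `[0,T]` the feeders of `a` (shell `n-1`) are
`≤ 2A` in modulus, the in-shell partners `j ≠ a` of `a` (shell `n`) lie in `[0, A]`, the in-shell pump
partners of `e` (shell `n+1`) and the feed targets of `e` (shell `n+2`) are `≤ A`, shells `n, n+1, n+2`
are non-negative, every mode is bounded by some `W`, and `X_{a,n}(0) ≤ 10RA`: then `X_{a,n} < 20R·A` on
`[0,T]`, for EVERY `ν ≥ 0` (constants: `Ī = 32Λ_n A²`, `ρ̄₀ = ρ̄ = 8Λ_{n+1}A`, `S = 20RA`; the two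
conditions of the uniform lemma reduce to `24576 + 81920·R·Λ_{n+1}/Λ_n < 7·(20)^4 R⁴ w²` and
`32(1+ε₀)² ≤ 160R(1+ε₀)^{5/2}`). The per-solution assembly over all sources and the class-level
conditional towards `FwdCeilingKPAt` are in the companion file `…KPSecondaryAssembly`.

HONEST FRAMING: an inequality about Tao-type MODEL lattice tables (rung TL-M2Break, route
SubOnsagerCeiling); an ingredient of, not a proof of, the crux; nothing here bears on Navier–Stokes.
-/

noncomputable section

-- the sub-problem namespace `NavierStokesRegularity.NavierStokesRegularity` is the tree's layout (D-0017)
set_option linter.dupNamespace false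

namespace Summit.NavierStokesRegularity.NavierStokesRegularity.Theorems

open Set Finset Filter Topology
open Literature.Analysis.FluidPDE.TaoCascade

/-! ## The secondary barrier at envelope scale (explicit constant `20 R`) -/

set_option maxHeartbeats 400000 in
/-- **SECONDARY BARRIER AT ENVELOPE SCALE.** KP network proper of `E₂(R)` (so `|α| ≤ 1` on the shift
set and a non-zero feed weight is `≥ 1/R`), `0 < ε₀ ≤ 1`, an honest `ν`-viscous solution piece on
`[0,T]` for a source `a` at shell `n` with target `e` (`α a a e (0,0,1) ≠ 0`) and a SCALE `A > 0` such
that along `[0,T]`: the feeders of `a` at shell `n-1` are `≤ 2A` in modulus, the in-shell partners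
`j ≠ a` of `a` at shell `n` are in `[0, A]`, the modes at shells `n+1, n+2` are `≥ 0` with the pump
partners of `e` (shell `n+1`) and the feed targets of `e` (shell `n+2`) `≤ A`, every other mode merely
bounded (`|X| ≤ W`), and `X_{a,n}(0) ≤ 10 R A`. Then `X_{a,n} < 20 R · A` on `[0,T]`, for EVERY `ν ≥ 0`.
(Instance of `kpProper_source_envelope_uniform` with `Ī = 32 Λ_n A²`, `ρ̄₀ = ρ̄ = 8 Λ_{n+1} A`,
`S = 20 R A`.) MODEL lattice statement. [this file] -/
theorem kpProper_secondary_barrier {ε₀ ν T A R W : ℝ}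
    {α : Fin 4 → Fin 4 → Fin 4 → ℤ × ℤ × ℤ → ℝ}
    {X : Fin 4 → ℤ → ℝ → ℝ} (hα : InTableClass R α)
    (hO : ∀ (Y : Fin 4 → ℤ → ℝ → ℝ) (τ : ℝ), (∀ (j : Fin 4) (k : ℤ), 1 ≤ k → 0 ≤ Y j k τ) →
      ∀ δ : ℝ, 0 < δ → ∀ (i : Fin 4) (n : ℤ), 1 ≤ n → Y i n τ = 0 → 0 ≤ quadTerm δ α Y i n τ)
    (hD : ∀ a b i : Fin 4, a ≠ b → α a b i (0, 0, 1) = 0)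
    (hR : 1 ≤ R) (hε : 0 < ε₀) (hε1 : ε₀ ≤ 1) (hν : 0 ≤ ν) (a e : Fin 4) (n : ℤ)
    (hw : α a a e (0, 0, 1) ≠ 0) (hA : 0 < A)
    (hXa : ∀ t ∈ Icc 0 T, HasDerivWithinAt (X a n)
      (quadTerm ε₀ α X a n t - ν * (1 + ε₀) ^ ((2 : ℝ) * n) * X a n t) (Icc 0 T) t)
    (hXe : ∀ t ∈ Icc 0 T, HasDerivWithinAt (X e (n + 1))
      (quadTerm ε₀ α X e (n + 1) t - ν * (1 + ε₀) ^ ((2 : ℝ) * (((n + 1 : ℤ)) : ℝ)) * X e (n + 1) t)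
        (Icc 0 T) t)
    (hWbd : ∀ t ∈ Icc 0 T, ∀ j (k : ℤ), |X j k t| ≤ W)
    (hfeeders : ∀ t ∈ Icc 0 T, ∀ j, α j j a (0, 0, 1) ≠ 0 → |X j (n - 1) t| ≤ 2 * A)
    (hn0 : ∀ t ∈ Icc 0 T, ∀ j, 0 ≤ X j n t)
    (hface : ∀ t ∈ Icc 0 T, ∀ i₁ i₂, i₁ ≠ a → i₂ ≠ a → α i₁ i₂ a (0, 0, 0) ≠ 0 →
      X i₁ n t ≤ A ∧ X i₂ n t ≤ A)
    (hn1 : ∀ t ∈ Icc 0 T, ∀ j, 0 ≤ X j (n + 1) t)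
    (hpumps : ∀ t ∈ Icc 0 T, ∀ j, j ≠ e → α e e j (0, 0, 0) ≠ 0 → X j (n + 1) t ≤ A)
    (hn2 : ∀ t ∈ Icc 0 T, ∀ j, 0 ≤ X j (n + 2) t)
    (htargets : ∀ t ∈ Icc 0 T, ∀ j, α e e j (0, 0, 1) ≠ 0 → X j (n + 2) t ≤ A)
    (hinit : X a n 0 ≤ 10 * R * A) :
    ∀ t ∈ Icc 0 T, X a n t < 20 * R * A := by
  obtain ⟨hs, hc, hcomp⟩ := hα
  have hb : (0 : ℝ) < 1 + ε₀ := by linarith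
  have hb1 : (1 : ℝ) ≤ 1 + ε₀ := by linarith
  by_cases hT : (0 : ℝ) ≤ T
  swap
  · intro t ht; exact absurd (ht.1.trans ht.2) hT
  have h0 : (0 : ℝ) ∈ Icc (0 : ℝ) T := ⟨le_rfl, hT⟩
  have hR0 : 0 < R := by linarith
  have hW0 : 0 ≤ W := (abs_nonneg _).trans (hWbd 0 h0 a n)
  -- coefficient facts
  have hfeed := kpProper_feed_nonneg hO
  have hw0 : 0 < α a a e (0, 0, 1) := lt_of_le_of_ne (hfeed a e) (Ne.symm hw)
  have hwR : R⁻¹ ≤ α a a e (0, 0, 1) := by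
    rcases (hcomp a a e _ kpProper_mem001).2 with h | h
    · exact absurd h hw
    · rwa [abs_of_pos hw0] at h
  have hcoef1 : ∀ i₁ i₂ i₃ : Fin 4, |α i₁ i₂ i₃ (0, 0, 1)| ≤ 1 := fun i₁ i₂ i₃ =>
    (hcomp i₁ i₂ i₃ _ kpProper_mem001).1
  have hcoef0 : ∀ i₁ i₂ i₃ : Fin 4, |α i₁ i₂ i₃ (0, 0, 0)| ≤ 1 := fun i₁ i₂ i₃ =>
    (hcomp i₁ i₂ i₃ _ kpProper_mem000).1
  -- the scales
  set Lm : ℝ := (1 + ε₀) ^ ((5 : ℝ) * ((n : ℝ) - 1) / 2) with hLm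
  set L0 : ℝ := (1 + ε₀) ^ ((5 : ℝ) * n / 2) with hL0
  set L1 : ℝ := (1 + ε₀) ^ ((5 : ℝ) * (((n + 1 : ℤ) : ℝ)) / 2) with hL1
  have hLm0 : 0 < Lm := Real.rpow_pos_of_pos hb _
  have hL00 : 0 < L0 := Real.rpow_pos_of_pos hb _
  have hL10 : 0 < L1 := Real.rpow_pos_of_pos hb _
  have hLmL0 : Lm ≤ L0 := by
    apply Real.rpow_le_rpow_of_exponent_le hb1
    have : (0 : ℝ) ≤ 5 / 2 := by norm_num
    nlinarith
  have hL1eq : L1 = L0 * (1 + ε₀) ^ ((5 : ℝ) / 2) := by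
    rw [hL1, hL0, ← Real.rpow_add hb]; congr 1; push_cast; ring
  have hb52 : (1 + ε₀) ^ ((5 : ℝ) / 2) ≤ 8 := by
    have h4 : (1 + ε₀) ^ ((5 : ℝ) / 2) ≤ (1 + ε₀) ^ ((3 : ℕ) : ℝ) :=
      Real.rpow_le_rpow_of_exponent_le hb1 (by norm_num)
    rw [Real.rpow_natCast] at h4
    have h5 : (1 + ε₀) ^ (3 : ℕ) ≤ 2 ^ (3 : ℕ) := pow_le_pow_left₀ hb.le (by linarith) 3
    nlinarith
  have hL1le : L1 ≤ 8 * L0 := by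
    rw [hL1eq]; nlinarith [Real.rpow_pos_of_pos hb ((5 : ℝ) / 2)]
  have hL0L1 : L0 * (1 + ε₀) ^ (2 : ℝ) ≤ L1 := by
    rw [hL1eq]
    exact mul_le_mul_of_nonneg_left (Real.rpow_le_rpow_of_exponent_le hb1 (by norm_num)) hL00.le
  classical
  -- the envelope vectors fed to the uniform pair lemma (irrelevant coordinates get the crude bound `W`)
  set B₀ : Fin 4 → ℝ := fun j => if α j j a (0, 0, 1) ≠ 0 then 2 * A else W with hB₀
  set B₁ : Fin 4 → ℝ := fun j =>
    if (∃ i, i ≠ a ∧ (α j i a (0, 0, 0) ≠ 0 ∨ α i j a (0, 0, 0) ≠ 0)) then A else W with hB₁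
  set B₂ : Fin 4 → ℝ := fun j => if (j ≠ e ∧ α e e j (0, 0, 0) ≠ 0) then A else W with hB₂
  set B₃ : Fin 4 → ℝ := fun j => if α e e j (0, 0, 1) ≠ 0 then A else W with hB₃
  have hXleW : ∀ t ∈ Icc 0 T, ∀ j (k : ℤ), X j k t ≤ W := fun t ht j k => (le_abs_self _).trans (hWbd t ht j k)
  have hB₀ok : ∀ t ∈ Icc 0 T, ∀ j, |X j (n - 1) t| ≤ B₀ j := by
    intro t ht j
    by_cases h : α j j a (0, 0, 1) ≠ 0
    · simp only [hB₀, h, if_true, ne_eq, not_false_eq_true]; exact hfeeders t ht j h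
    · simp only [hB₀, h, if_false]; exact hWbd t ht j (n - 1)
  have hB₁ok : ∀ t ∈ Icc 0 T, ∀ j, 0 ≤ X j n t ∧ (j ≠ a → X j n t ≤ B₁ j) := by
    intro t ht j
    refine ⟨hn0 t ht j, fun hja => ?_⟩
    by_cases h : ∃ i, i ≠ a ∧ (α j i a (0, 0, 0) ≠ 0 ∨ α i j a (0, 0, 0) ≠ 0)
    · simp only [hB₁, h, if_true]
      obtain ⟨i, hia, hor⟩ := h
      rcases hor with h1 | h1
      · exact (hface t ht j i hja hia h1).1
      · exact (hface t ht i j hia hja h1).2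
    · simp only [hB₁, h, if_false]; exact hXleW t ht j n
  have hB₂ok : ∀ t ∈ Icc 0 T, ∀ j, 0 ≤ X j (n + 1) t ∧ X j (n + 1) t ≤ B₂ j := by
    intro t ht j
    refine ⟨hn1 t ht j, ?_⟩
    by_cases h : j ≠ e ∧ α e e j (0, 0, 0) ≠ 0
    · have hB : B₂ j = A := by simp only [hB₂]; exact if_pos h
      rw [hB]; exact hpumps t ht j h.1 h.2
    · have hB : B₂ j = W := by simp only [hB₂]; exact if_neg h
      rw [hB]; exact hXleW t ht j (n + 1)
  have hB₃ok : ∀ t ∈ Icc 0 T, ∀ j, 0 ≤ X j (n + 2) t ∧ X j (n + 2) t ≤ B₃ j := by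
    intro t ht j
    refine ⟨hn2 t ht j, ?_⟩
    by_cases h : α e e j (0, 0, 1) ≠ 0
    · simp only [hB₃, h, if_true, ne_eq, not_false_eq_true]; exact htargets t ht j h
    · simp only [hB₃, h, if_false]; exact hXleW t ht j (n + 2)
  -- sizes of the sums
  have hpump : ∀ j, 0 ≤ α e e j (0, 0, 0) := by
    intro j
    by_cases hje : j = e
    · rw [hje, kpProper_inShell_diag_zero hc e]
    · exact kpProper_pump_nonneg hO hje
  have hsum0 : ∑ j, α j j a (0, 0, 1) * B₀ j ^ 2 ≤ 16 * A ^ 2 := by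
    have hterm : ∀ j, α j j a (0, 0, 1) * B₀ j ^ 2 ≤ 4 * A ^ 2 := by
      intro j
      by_cases h : α j j a (0, 0, 1) ≠ 0
      · simp only [hB₀, h, if_true, ne_eq, not_false_eq_true]
        have h1 : α j j a (0, 0, 1) ≤ 1 := (le_abs_self _).trans (hcoef1 j j a)
        nlinarith [hfeed j a]
      · push Not at h; rw [h]; nlinarith
    calc ∑ j, α j j a (0, 0, 1) * B₀ j ^ 2 ≤ ∑ _j : Fin 4, 4 * A ^ 2 := Finset.sum_le_sum fun j _ => hterm j
      _ = 16 * A ^ 2 := by simp [Finset.sum_const, Finset.card_univ, Fintype.card_fin]; ring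
  have hsum1 : ∑ i₁, ∑ i₂, |α i₁ i₂ a (0, 0, 0)| *
      (Function.update B₁ a 0 i₁ * Function.update B₁ a 0 i₂) ≤ 16 * A ^ 2 := by
    have hterm : ∀ i₁ i₂, |α i₁ i₂ a (0, 0, 0)| *
        (Function.update B₁ a 0 i₁ * Function.update B₁ a 0 i₂) ≤ A ^ 2 := by
      intro i₁ i₂
      by_cases h1 : i₁ = a
      · simp [Function.update, h1]; positivity
      by_cases h2 : i₂ = a
      · simp [Function.update, h2]; positivity
      by_cases h3 : α i₁ i₂ a (0, 0, 0) = 0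
      · rw [h3]; simp; positivity
      have hr1 : ∃ i, i ≠ a ∧ (α i₁ i a (0, 0, 0) ≠ 0 ∨ α i i₁ a (0, 0, 0) ≠ 0) := ⟨i₂, h2, Or.inl h3⟩
      have hr2 : ∃ i, i ≠ a ∧ (α i₂ i a (0, 0, 0) ≠ 0 ∨ α i i₂ a (0, 0, 0) ≠ 0) := ⟨i₁, h1, Or.inr h3⟩
      have e1 : Function.update B₁ a 0 i₁ = A := by simp [Function.update, h1, hB₁, hr1]
      have e2 : Function.update B₁ a 0 i₂ = A := by simp [Function.update, h2, hB₁, hr2]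
      rw [e1, e2]
      have : |α i₁ i₂ a (0, 0, 0)| ≤ 1 := hcoef0 i₁ i₂ a
      nlinarith [abs_nonneg (α i₁ i₂ a (0, 0, 0))]
    calc ∑ i₁, ∑ i₂, |α i₁ i₂ a (0, 0, 0)| * (Function.update B₁ a 0 i₁ * Function.update B₁ a 0 i₂)
        ≤ ∑ _i₁ : Fin 4, ∑ _i₂ : Fin 4, A ^ 2 :=
          Finset.sum_le_sum fun i₁ _ => Finset.sum_le_sum fun i₂ _ => hterm i₁ i₂
      _ = 16 * A ^ 2 := by simp [Finset.sum_const, Finset.card_univ, Fintype.card_fin]; ring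
  have hsum2 : ∑ j, α e e j (0, 0, 0) * B₂ j ≤ 4 * A := by
    have hterm : ∀ j, α e e j (0, 0, 0) * B₂ j ≤ A := by
      intro j
      by_cases h : j ≠ e ∧ α e e j (0, 0, 0) ≠ 0
      · have hB : B₂ j = A := by simp only [hB₂]; exact if_pos h
        rw [hB]
        have : α e e j (0, 0, 0) ≤ 1 := (le_abs_self _).trans (hcoef0 e e j)
        nlinarith [hpump j]
      · have hz : α e e j (0, 0, 0) = 0 := by
          by_cases hje : j = e
          · rw [hje]; exact kpProper_inShell_diag_zero hc e
          · by_contra hne; exact h ⟨hje, hne⟩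
        rw [hz]; simp; exact hA.le
    calc ∑ j, α e e j (0, 0, 0) * B₂ j ≤ ∑ _j : Fin 4, A := Finset.sum_le_sum fun j _ => hterm j
      _ = 4 * A := by simp [Finset.sum_const, Finset.card_univ, Fintype.card_fin]
  have hsum3 : ∑ j, α e e j (0, 0, 1) * B₃ j ≤ 4 * A := by
    have hterm : ∀ j, α e e j (0, 0, 1) * B₃ j ≤ A := by
      intro j
      by_cases h : α e e j (0, 0, 1) ≠ 0
      · simp only [hB₃, h, if_true, ne_eq, not_false_eq_true]
        have : α e e j (0, 0, 1) ≤ 1 := (le_abs_self _).trans (hcoef1 e e j)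
        nlinarith [hfeed e j]
      · push Not at h; rw [h]; simp; exact hA.le
    calc ∑ j, α e e j (0, 0, 1) * B₃ j ≤ ∑ _j : Fin 4, A := Finset.sum_le_sum fun j _ => hterm j
      _ = 4 * A := by simp [Finset.sum_const, Finset.card_univ, Fintype.card_fin]
  -- apply the uniform lemma with `Ī = 32 L0 A²`, `ρ̄₀ = ρ̄ = 8 L1 A`, `S = 20 R A`
  have hS : 0 < 20 * R * A := by positivity
  have hρbar : 0 < 8 * L1 * A := by positivity
  refine kpProper_source_envelope_uniform (Ibar := 32 * L0 * A ^ 2) (ρ0bar := 8 * L1 * A)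
    (ρbar := 8 * L1 * A) hs hc hO hD hε hν a e n hw0 hS hρbar hXa hXe hB₀ok hB₁ok hB₂ok hB₃ok
    ?_ ?_ ?_ ?_ (by linarith)
  · -- hIle
    have h1 : Lm * ∑ j, α j j a (0, 0, 1) * B₀ j ^ 2 ≤ L0 * (16 * A ^ 2) := by
      have hs0 : 0 ≤ ∑ j, α j j a (0, 0, 1) * B₀ j ^ 2 :=
        Finset.sum_nonneg fun j _ => mul_nonneg (hfeed j a) (sq_nonneg _)
      calc Lm * ∑ j, α j j a (0, 0, 1) * B₀ j ^ 2 ≤ Lm * (16 * A ^ 2) :=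
            mul_le_mul_of_nonneg_left hsum0 hLm0.le
        _ ≤ L0 * (16 * A ^ 2) := mul_le_mul_of_nonneg_right hLmL0 (by positivity)
    have h2 : L0 * ∑ i₁, ∑ i₂, |α i₁ i₂ a (0, 0, 0)| *
        (Function.update B₁ a 0 i₁ * Function.update B₁ a 0 i₂) ≤ L0 * (16 * A ^ 2) :=
      mul_le_mul_of_nonneg_left hsum1 hL00.le
    rw [← hLm, ← hL0]
    linarith
  · -- hρle
    have : L1 * (∑ j, α e e j (0, 0, 1) * B₃ j + ∑ j, α e e j (0, 0, 0) * B₂ j) ≤ L1 * (4 * A + 4 * A) :=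
      mul_le_mul_of_nonneg_left (by linarith) hL10.le
    rw [← hL1]
    linarith
  · -- hcond: 24 Ī² + 8 Ī (ρ̄₀ + ρ̄) S < 7 λ² S⁴
    have hwR1 : 1 ≤ α a a e (0, 0, 1) * R := by
      have := mul_le_mul_of_nonneg_right hwR hR0.le
      rwa [inv_mul_cancel₀ hR0.ne'] at this
    have hA4 : 0 < A ^ 4 := by positivity
    have hkey : 24576 * L0 ^ 2 + 81920 * R * L0 * L1 <
        1120000 * (α a a e (0, 0, 1)) ^ 2 * R ^ 4 * L0 ^ 2 := by
      have hRL : 0 ≤ R * L0 := by positivity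
      have h1a : R * L0 * L1 ≤ R * L0 * (8 * L0) := mul_le_mul_of_nonneg_left hL1le hRL
      have hRR : R ≤ R ^ 2 := by nlinarith
      have h1b : R * L0 ^ 2 ≤ R ^ 2 * L0 ^ 2 := mul_le_mul_of_nonneg_right hRR (sq_nonneg _)
      have h1c : R * L0 * (8 * L0) = 8 * (R * L0 ^ 2) := by ring
      have hR2 : 1 ≤ R ^ 2 := one_le_pow₀ hR
      have h2 : L0 ^ 2 ≤ R ^ 2 * L0 ^ 2 := le_mul_of_one_le_left (sq_nonneg _) hR2
      have hwR2 : 1 ≤ (α a a e (0, 0, 1) * R) ^ 2 := one_le_pow₀ hwR1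
      have h3 : R ^ 2 * L0 ^ 2 ≤ (α a a e (0, 0, 1) * R) ^ 2 * (R ^ 2 * L0 ^ 2) :=
        le_mul_of_one_le_left (by positivity) hwR2
      have h3' : (α a a e (0, 0, 1) * R) ^ 2 * (R ^ 2 * L0 ^ 2) =
          (α a a e (0, 0, 1)) ^ 2 * R ^ 4 * L0 ^ 2 := by ring
      have hpos : 0 < R ^ 2 * L0 ^ 2 := by positivity
      rw [h3'] at h3
      linarith [h1a, h1b, h1c, h2, h3, hpos]
    have hfin : 24 * (32 * L0 * A ^ 2) ^ 2 + 8 * (32 * L0 * A ^ 2) * (8 * L1 * A + 8 * L1 * A) * (20 * R * A)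
        < 7 * (α a a e (0, 0, 1) * L0) ^ 2 * (20 * R * A) ^ 4 := by
      have h := mul_lt_mul_of_pos_right hkey hA4
      have e1 : 24 * (32 * L0 * A ^ 2) ^ 2 + 8 * (32 * L0 * A ^ 2) * (8 * L1 * A + 8 * L1 * A) * (20 * R * A)
          = (24576 * L0 ^ 2 + 81920 * R * L0 * L1) * A ^ 4 := by ring
      have e2 : 7 * (α a a e (0, 0, 1) * L0) ^ 2 * (20 * R * A) ^ 4
          = (1120000 * (α a a e (0, 0, 1)) ^ 2 * R ^ 4 * L0 ^ 2) * A ^ 4 := by ring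
      rw [e1, e2]; exact h
    simpa only [hL0] using hfin
  · -- hdamp: Ī (1+ε₀)² ≤ ρ̄ S
    have h1 : 32 * L0 * A ^ 2 * (1 + ε₀) ^ (2 : ℝ) = 32 * A ^ 2 * (L0 * (1 + ε₀) ^ (2 : ℝ)) := by ring
    have h2 : 8 * L1 * A * (20 * R * A) = 160 * R * A ^ 2 * L1 := by ring
    rw [h1, h2]
    have h3 : 32 * A ^ 2 * (L0 * (1 + ε₀) ^ (2 : ℝ)) ≤ 32 * A ^ 2 * L1 :=
      mul_le_mul_of_nonneg_left hL0L1 (by positivity)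
    have h4 : 32 * A ^ 2 * L1 ≤ 160 * R * A ^ 2 * L1 := by
      have : 0 ≤ A ^ 2 * L1 := by positivity
      nlinarith
    linarith

end Summit.NavierStokesRegularity.NavierStokesRegularity.Theorems

end
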